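import Literature.AlgebraicGeometry.HodgeTheory.ChernCharacterLawsCoherent
import Literature.AlgebraicGeometry.HodgeTheory.HolomorphicBundleChernCharacterTopDegree
import Literature.AlgebraicGeometry.HodgeTheory.HodgeRiemannDegreeOne
import Literature.AlgebraicGeometry.Deligne1982.SplitWeilTypeCMIsometry
import Literature.AlgebraicGeometry.Motives.SegreHyperplaneClass
import HarnessLib

/-!
# A lawful non-degenerate Chern datum sees the hyperplane class: `ch_p(𝒪_X(-1)) ≠ 0` for `p ≤ dim X`, and the span law in the
# top degree and on curves

Family `hodge`, layer `Literature/AlgebraicGeometry/HodgeTheory`. HONEST FRAMING: nothing here constructs a Chern character or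
bears on any case of the Hodge conjecture; `ChernCharacterBetti` stays a hypothesis structure without an instance. Sequel to
`HodgeTheory/ChernCharacterBettiLaws` (the predicate `ChernDatum.IsTopological` = the nine topological laws of a raw datum
`ch : ChernDatum`, and `ChernDatum.NonDegenerate`) and `HodgeTheory/ChernCharacterLawsRigidity` (non-degeneracy produces a projective
space `ℙᵃ`, `a ≥ 1`, whose tautological class `t_a(ch) = ch₁(𝒪_{ℙᵃ}(-1))` is non-zero, and `t` is compatible with Segre slices).

For a datum `ch` with the nine laws and NON-DEGENERATE, and `X` smooth projective of dimension `n ≥ 1`: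

* §1 `exists_projectiveEmbedding_ch_serreTwist_one_ne_zero` — **`X` embeds in a projective space `ℙᴷ` with `t_K(ch) ≠ 0`**:
  compose any closed immersion `ι : X ↪ ℙᴺ` with the Segre slice `ℙᴺ × {pt} ↪ ℙᴺ × ℙᵃ ↪ ℙᴷ`, `K = Na + N + a` (Hartshorne II
  Ex. 5.11); `t_K ≠ 0` because the other slice `{pt} × ℙᵃ ↪ ℙᴷ` pulls `𝒪(-1)` back to `𝒪(-1)` and `t_a ≠ 0`
  (`exists_segre_detClass_eq'`, `map_ch_serreTwist_one_eq_of_detClass_eq`).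
* §2 `exists_hasRank_one_cupPowTwo_ch_one_ne_zero` ∕ `exists_hasRank_one_ch_ne_zero` — **for `1 ≤ p ≤ n` some line bundle `L` on
  `X` (namely `e^*𝒪_{ℙᴷ}(-1)`) has `ch₁(L)ᵖ ≠ 0`, hence `ch_p(L) = ch₁(L)ᵖ/p! ≠ 0`**: `ch₁(e^*𝒪(-1)) = e^* t_K` (functoriality law),
  `t_K` is RATIONAL (rationality law) and non-zero, so a non-zero real multiple of `e^* t_K` is a Kähler class (Voisin I Thm. 7.10 ∕
  §3.3.2 on the tree's carriers: `Deligne1982.exists_isKaehlerClass_smul_map_ι`), whose powers up to the dimension do not vanish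
  (Voisin I Cor. 3.9: `IsKaehlerClass.cupPowTwo_ne_zero`); then the exponential law on rank `≤ 1`.
* §3 `span_ch_eq_top_of_degree_top`, `algebraicClasses_le_span_ch_of_degree_top` — **the span law in the top degree**:
  `H²ⁿ(X(ℂ); ℂ)` is a line (`finrank_complexBetti_two_mul_eq_one`, Poincaré duality) containing the non-zero `ch_n(e^*𝒪(-1))`, so
  `ℂ · {ch_n(E) : E a vector bundle} = H²ⁿ ⊇ Nⁿ H²ⁿ`; and `algebraicClasses_le_span_ch_of_dim_le_one` — **on a smooth projective
  CURVE (or a point) the span law holds in every positive degree for every lawful non-degenerate datum** (degree `1` is the top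
  degree, degrees `≥ 2` vanish: `ChernDatum.algebraicClasses_le_span_of_dim_lt` of `HodgeTheory/ChernCharacterLawsCoherent`).

In print: Fulton Example 15.2.16 (b) (`ch : K(X)_ℚ ⥲ A(X)_ℚ` for `X` non-singular) in the top degree, where `Aⁿ(X)_ℚ → H²ⁿ = ℚ · [pt]`
(Voisin I §11.1.2, Thm. 11.32) and `ch_n(𝒪_X(1)) = hⁿ/n!` with `deg hⁿ = deg X > 0`. Everything is proved; no definition, no named
fact, no instance, no notation.

## References

* [Fulton1998] W. Fulton, Intersection Theory, 2nd ed. (1998): §15.1 (ii)–(iii), Example 15.2.16 (b).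
* [VoisinHodgeI2002] C. Voisin, Hodge Theory and Complex Algebraic Geometry I (2002): §3.1.3 Cor. 3.9, §3.3.2 Lemma 3.16, Thm. 7.10,
  Thm. 7.14, §11.1.2, Thm. 11.32.
* [Hartshorne1977] R. Hartshorne, Algebraic Geometry (1977): II Ex. 5.11, II Prop. 5.12 (c), III Ex. 4.5.
* [Grothendieck1958] A. Grothendieck, La théorie des classes de Chern, Bull. SMF 86 (1958): Thm. 1.
* [HatcherAT2002] A. Hatcher, Algebraic Topology (2002): §3.2, §3.3 Cor. 3.37.
* Tree: `HodgeTheory/ChernCharacterBettiLaws`, `HodgeTheory/ChernCharacterLawsRigidity`, `HodgeTheory/ChernCharacterBettiUniqueness`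
  (`exists_segre_detClass_eq'`), `Deligne1982/SplitWeilTypeCMIsometry` (`exists_isKaehlerClass_smul_map_ι`), `HodgeTheory/KaehlerClass`,
  `HodgeTheory/HolomorphicBundleChernCharacterTopDegree` (`finrank_complexBetti_two_mul_eq_one`), `Motives/SegreEmbedding`.
-/

noncomputable section

open CategoryTheory CategoryTheory.Limits AlgebraicGeometry MonoidalCategory CartesianMonoidalCategory
open Literature.AlgebraicTopology.SingularHomology
open Literature.AlgebraicGeometry.Morphisms.ProjCech (PP)
open Literature.AlgebraicGeometry.Modules.SerreTwist (serreTwist isFiniteLocallyFree_serreTwist hasRank_serreTwist)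
open Literature.AlgebraicGeometry.Motives

namespace Literature.AlgebraicGeometry.HodgeTheory

namespace ChernDatum.IsTopological

section HodgeTheory

variable {ch : ChernDatum} {n : ℕ} {X : SchemeOver ℂ}

/-! ### §1 An embedding of `X` whose ambient tautological class is seen by `ch` -/

/-- **Non-degeneracy produces a non-zero tautological class `t_a(ch) = ch₁(𝒪_{ℙᵃ}(-1))`, `a ≥ 1`** (bundled form of
`exists_ch_serreTwist_one_ne_zero_of_nonDegenerate`). [cite: Grothendieck1958, Thm. 1 (uniqueness)]
[cite: Hartshorne1977, II Thm. 7.1 and II Ex. 5.8 (b)] -/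
theorem exists_ch_serreTwist_one_ne_zero (h : ch.IsTopological) (hnd : ch.NonDegenerate) :
    ∃ a : ℕ, 1 ≤ a ∧ ch (projectiveSpace a ℂ)
        (serreTwist (𝟙 (projectiveSpace a ℂ).left : (projectiveSpace a ℂ).left ⟶ PP ℂ a) 1) 1 ≠ 0 :=
  exists_ch_serreTwist_one_ne_zero_of_nonDegenerate ch h.ch_congr h.ch_shortExact h.map_ch h.ch_free_of_pos hnd

/-- **A smooth projective `X` embeds in a projective space `ℙᴷ` whose tautological class `t_K(ch) = ch₁(𝒪_{ℙᴷ}(-1))` is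
NON-ZERO**, for a lawful non-degenerate `ch`: compose a closed immersion `ι : X ↪ ℙᴺ` with the Segre slice
`ℙᴺ = ℙᴺ × {pt} ↪ ℙᴺ ×_ℂ ℙᵃ ↪ ℙᴷ`, `K = Na + N + a`, where `t_a(ch) ≠ 0`; the slice `{pt} × ℙᵃ ↪ ℙᴷ` pulls `𝒪(-1)` back to
`𝒪(-1)` (II Ex. 5.11), so `σ'^* t_K = t_a ≠ 0`. [cite: Hartshorne1977, II Ex. 5.11 (p. 125) and II Ex. 4.9]
[cite: Grothendieck1958, Thm. 1] -/
theorem exists_projectiveEmbedding_ch_serreTwist_one_ne_zero (h : ch.IsTopological) (hnd : ch.NonDegenerate)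
    (hX : IsSmoothProjective n X) :
    ∃ e : ProjectiveEmbedding X, ch (projectiveSpace e.n ℂ)
        (serreTwist (𝟙 (projectiveSpace e.n ℂ).left : (projectiveSpace e.n ℂ).left ⟶ PP ℂ e.n) 1) 1 ≠ 0 := by
  obtain ⟨a, -, hta⟩ := h.exists_ch_serreTwist_one_ne_zero hnd
  obtain ⟨N, ι, hι⟩ := hX.isProjectiveOver
  obtain ⟨P⟩ := (isSmoothProjective_projectiveSpace_holds ℂ a).nonempty_algPoints ℂ
  -- the Segre slice `Σ = (ι, const_P) ≫ σ_{N,a} : X ↪ ℙᴷ`, a closed immersion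
  haveI := SegreHyperplaneClass.isSeparated_projectiveSpace_hom a
  haveI : IsClosedImmersion (lift ι (toSpecOver X ≫ P)).left := by
    have hc : (lift ι (toSpecOver X ≫ P)).left ≫ (fst (projectiveSpace N ℂ) (projectiveSpace a ℂ)).left = ι.left := by
      rw [← Over.comp_left, lift_fst]
    haveI : IsSeparated (fst (projectiveSpace N ℂ) (projectiveSpace a ℂ)).left :=
      inferInstanceAs (IsSeparated (pullback.fst (projectiveSpace N ℂ).hom (projectiveSpace a ℂ).hom))
    haveI : IsClosedImmersion ((lift ι (toSpecOver X ≫ P)).left ≫ (fst (projectiveSpace N ℂ) (projectiveSpace a ℂ)).left) := by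
      rw [hc]
      infer_instance
    exact IsClosedImmersion.of_comp _ (fst (projectiveSpace N ℂ) (projectiveSpace a ℂ)).left
  haveI : IsClosedImmersion (lift ι (toSpecOver X ≫ P) ≫ segreEmbedding N a ℂ).left := by
    rw [Over.comp_left]
    infer_instance
  refine ⟨⟨N * a + N + a, lift ι (toSpecOver X ≫ P) ≫ segreEmbedding N a ℂ, inferInstance⟩, ?_⟩
  -- `t_K ≠ 0`: the other slice pulls `𝒪(-1)` back to `𝒪(-1)` and `t_a ≠ 0`
  obtain ⟨σ', hσ'⟩ := exists_segre_detClass_eq' N a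
  intro h0
  apply hta
  rw [← map_ch_serreTwist_one_eq_of_detClass_eq ch h.ch_congr h.map_ch σ' hσ', h0, map_zero]

/-! ### §2 Powers of `ch₁` of the restricted tautological bundle -/

/-- **For `1 ≤ p ≤ dim X` some line bundle `L` on the smooth projective `X` has `ch₁(L)ᵖ ≠ 0`** — `L = e^*𝒪_{ℙᴷ}(-1)` for the
embedding `e` of §1: `ch₁(L) = e^* t_K` by functoriality, `t_K` is rational and non-zero, so a non-zero real multiple of `e^* t_K` is a
KÄHLER class (the restricted Fubini–Study class), whose `p`-th power is non-zero for `p ≤ dim X`.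
[cite: VoisinHodgeI2002, §3.1.3 Cor. 3.9, §3.3.2 Lemma 3.16 and Thm. 7.10] [cite: Fulton1998, §15.1 (ii)] -/
theorem exists_hasRank_one_cupPowTwo_ch_one_ne_zero (h : ch.IsTopological) (hnd : ch.NonDegenerate)
    (hX : IsSmoothProjective n X) {p : ℕ} (hp1 : 1 ≤ p) (hpn : p ≤ n) :
    ∃ L : X.left.Modules, HasRank L 1 ∧ cupPowTwo (ch X L 1) p ≠ 0 := by
  obtain ⟨m, rfl⟩ : ∃ m, n = m + 1 := ⟨n - 1, by omega⟩
  obtain ⟨e, hte⟩ := h.exists_projectiveEmbedding_ch_serreTwist_one_ne_zero hnd hX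
  have hT := isFiniteLocallyFree_serreTwist
    (𝟙 (projectiveSpace e.n ℂ).left : (projectiveSpace e.n ℂ).left ⟶ PP ℂ e.n) 1
  have hrat := h.isRationalClass_ch _ _ hT.isVectorBundle 1
  obtain ⟨s, hs, hK⟩ := Deligne1982.exists_isKaehlerClass_smul_map_ι hX e hrat hte
  have hne := hK.cupPowTwo_ne_zero hX hp1 hpn
  refine ⟨(Scheme.Modules.pullback e.ι.left).obj
      (serreTwist (𝟙 (projectiveSpace e.n ℂ).left : (projectiveSpace e.n ℂ).left ⟶ PP ℂ e.n) 1),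
    Modules.hasRank_pullback e.ι.left
      (hasRank_serreTwist (𝟙 (projectiveSpace e.n ℂ).left : (projectiveSpace e.n ℂ).left ⟶ PP ℂ e.n) 1), ?_⟩
  have hmap := h.map_ch e.ι _ hT.isVectorBundle 1
  intro h0
  apply hne
  rw [cupPowTwo_smul, hmap, h0, smul_zero]

/-- **For `1 ≤ p ≤ dim X` some line bundle `L` on `X` has `ch_p(L) ≠ 0`** (`ch_p(L) = ch₁(L)ᵖ/p!` by the exponential law on
rank `≤ 1`). [cite: Fulton1998, §15.1 (iii)] [cite: VoisinHodgeI2002, §3.1.3 Cor. 3.9] -/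
theorem exists_hasRank_one_ch_ne_zero (h : ch.IsTopological) (hnd : ch.NonDegenerate) (hX : IsSmoothProjective n X)
    {p : ℕ} (hp1 : 1 ≤ p) (hpn : p ≤ n) : ∃ L : X.left.Modules, HasRank L 1 ∧ ch X L p ≠ 0 := by
  obtain ⟨L, hL, hne⟩ := h.exists_hasRank_one_cupPowTwo_ch_one_ne_zero hnd hX hp1 hpn
  refine ⟨L, hL, ?_⟩
  rw [h.ch_of_hasRankLE_one hL.hasRankLE (by omega : 0 < p)]
  exact smul_ne_zero (inv_ne_zero (Nat.cast_ne_zero.2 (Nat.factorial_ne_zero p))) hne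

/-- Hence **for `1 ≤ p ≤ dim X` the span `ℂ · {ch_p(E) : E a vector bundle on X}` is non-zero**. [cite: Fulton1998, Example 15.2.16 (b)] -/
theorem span_ch_ne_bot (h : ch.IsTopological) (hnd : ch.NonDegenerate) (hX : IsSmoothProjective n X) {p : ℕ} (hp1 : 1 ≤ p)
    (hpn : p ≤ n) : Submodule.span ℂ {c | ∃ E : X.left.Modules, IsVectorBundle E ∧ ch X E p = c} ≠ ⊥ := by
  obtain ⟨L, hL, hne⟩ := h.exists_hasRank_one_ch_ne_zero hnd hX hp1 hpn
  intro hbot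
  exact hne ((Submodule.eq_bot_iff _).1 hbot _ (Submodule.subset_span ⟨L, hL.hasRankLE.isVectorBundle, rfl⟩))

/-! ### §3 The span law in the top degree, and on curves -/

/-- **`ℂ · {ch_n(E) : E a vector bundle} = H²ⁿ(X(ℂ); ℂ)`** for `X` smooth projective of dimension `n ≥ 1` and `ch` lawful
non-degenerate: the line `H²ⁿ(X(ℂ); ℂ)` contains the non-zero `ch_n(e^*𝒪(-1))`. [cite: Fulton1998, Example 15.2.16 (b)]
[cite: VoisinHodgeI2002, Thm. 11.32 and §11.1.2] [cite: HatcherAT2002, §3.3 Cor. 3.37] -/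
theorem span_ch_eq_top_of_degree_top (h : ch.IsTopological) (hnd : ch.NonDegenerate) (hX : IsSmoothProjective n X)
    (hn : 1 ≤ n) : Submodule.span ℂ {c | ∃ E : X.left.Modules, IsVectorBundle E ∧ ch X E n = c} = ⊤ := by
  obtain ⟨L, hL, hne⟩ := h.exists_hasRank_one_ch_ne_zero hnd hX hn le_rfl
  have h1 := finrank_complexBetti_two_mul_eq_one hX
  haveI : FiniteDimensional ℂ (complexBetti X (2 * n)) := Module.finite_of_finrank_eq_succ h1
  have hspan : (ℂ ∙ ch X L n) = ⊤ :=
    Submodule.eq_top_of_finrank_eq (by rw [finrank_span_singleton hne, h1])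
  exact eq_top_iff.2 (hspan ▸ Submodule.span_mono (Set.singleton_subset_iff.2 ⟨L, hL.hasRankLE.isVectorBundle, rfl⟩))

/-- **The span law in the top degree**: `Nⁿ H²ⁿ(X(ℂ); ℂ) ⊆ ℂ · {ch_n(E)}` (`n = dim X ≥ 1`) for every lawful non-degenerate
datum. [cite: Fulton1998, Example 15.2.16 (b)] [cite: VoisinHodgeI2002, Thm. 11.32] -/
theorem algebraicClasses_le_span_ch_of_degree_top (h : ch.IsTopological) (hnd : ch.NonDegenerate)
    (hX : IsSmoothProjective n X) (hn : 1 ≤ n) :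
    algebraicClasses X n ≤ Submodule.span ℂ {c | ∃ E : X.left.Modules, IsVectorBundle E ∧ ch X E n = c} := by
  rw [h.span_ch_eq_top_of_degree_top hnd hX hn]
  exact le_top

/-- **The span law on curves and points**: for `X` smooth projective of dimension `≤ 1` and every lawful non-degenerate datum,
`Nᵖ H²ᵖ(X(ℂ); ℂ) ⊆ ℂ · {ch_p(E)}` in every positive degree (degree `1` is the top degree of a curve, degrees `p > dim X` vanish).
[cite: Fulton1998, Example 15.2.16 (b)] [cite: VoisinHodgeI2002, Thm. 11.32] -/
theorem algebraicClasses_le_span_ch_of_dim_le_one (h : ch.IsTopological) (hnd : ch.NonDegenerate)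
    (hX : IsSmoothProjective n X) (hn : n ≤ 1) {p : ℕ} (hp : 0 < p) :
    algebraicClasses X p ≤ Submodule.span ℂ {c | ∃ E : X.left.Modules, IsVectorBundle E ∧ ch X E p = c} := by
  rcases lt_or_ge n p with hnp | hnp
  · exact ChernDatum.algebraicClasses_le_span_of_dim_lt ch hX hnp
  · obtain rfl : p = n := by omega
    exact h.algebraicClasses_le_span_ch_of_degree_top hnd hX hp

end HodgeTheory

end ChernDatum.IsTopological

end Literature.AlgebraicGeometry.HodgeTheory

end
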